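import Summits.ABC.ABC.Theorems.SomeWindowSaving.Negative.Defs

/-!
# Crux `TwistAmplification.SomeWindowSaving` (stmt-ABC-1976): prime twists of the Frey family

Definitions for the negative-side (cdisprove) files: the translate `transModel a b r` of
`y² = x³ + a x² + b x`, the reducing shift `redShift`, and `twistFamily p d` — the reduced model of
the twist by a prime `d` of `freyFamily p`, i.e. of `y² = x (x − d)(x + d(4p² − 1))` — with its
covariants `c₄ = 16 d² (A²+AB+B²)`, `Δ = 16 d⁶ (AB(A+B))²`, `c₆ = −32 d³ (3k−1)(3k+2)(6k+1)`,
`(A, B) = (1, 3k)`, `k = (4p² − 1)/3`.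
-/

noncomputable section

open WeierstrassCurve

namespace Summit.ABC.ABC.Theorems.SomeWindowSaving.Negative

section TransModel

/-- The translate `x ↦ x + r` of `y² = x³ + a x² + b x`:
`⟨0, a + 3r, 0, b + 2ra + 3r², rb + r²a + r³⟩`. -/
def transModel (a b r : ℤ) : WeierstrassCurve ℤ :=
  ⟨0, a + 3 * r, 0, b + 2 * r * a + 3 * r ^ 2, r * b + r ^ 2 * a + r ^ 3⟩

/-- The shift making `a₂ ∈ {−1, 0, 1}`: `r = −⌊(a + 1)/3⌋`. -/
def redShift (a : ℤ) : ℤ := -((a + 1) / 3)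

/-- `a + 3 · redShift a ∈ {−1, 0, 1}`. -/
theorem redShift_spec (a : ℤ) :
    a + 3 * redShift a = -1 ∨ a + 3 * redShift a = 0 ∨ a + 3 * redShift a = 1 := by
  unfold redShift; omega

/-- `c₄ = 16 (a² − 3b)` (translation invariant). -/
theorem transModel_c₄ (a b r : ℤ) : (transModel a b r).c₄ = 16 * (a ^ 2 - 3 * b) := by
  simp only [transModel, WeierstrassCurve.c₄, WeierstrassCurve.b₂, WeierstrassCurve.b₄]; ring

/-- `c₆ = −32 a (2a² − 9b)` (translation invariant). -/
theorem transModel_c₆ (a b r : ℤ) : (transModel a b r).c₆ = -32 * a * (2 * a ^ 2 - 9 * b) := by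
  simp only [transModel, WeierstrassCurve.c₆, WeierstrassCurve.b₂, WeierstrassCurve.b₄,
    WeierstrassCurve.b₆]; ring

/-- `Δ = 16 b² (a² − 4b)` (translation invariant). -/
theorem transModel_Δ (a b r : ℤ) : (transModel a b r).Δ = 16 * b ^ 2 * (a ^ 2 - 4 * b) := by
  simp only [transModel, WeierstrassCurve.Δ, WeierstrassCurve.b₂, WeierstrassCurve.b₄,
    WeierstrassCurve.b₆, WeierstrassCurve.b₈]; ring

end TransModel

section TwistFamily

variable {p d : ℕ}

/-- The prime twist by `d` of `freyFamily p`, in reduced form: the translate by `redShift` of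
`y² = x (x − d)(x + 3kd)`, `k = (4p² − 1)/3` — the Frey curve of the non-primitive triple
`d + d(4p² − 1) = 4dp²`. -/
def twistFamily (p d : ℕ) : WeierstrassCurve ℤ :=
  transModel ((d : ℤ) * (3 * kOf p - 1)) (-(3 * kOf p * (d : ℤ) ^ 2))
    (redShift ((d : ℤ) * (3 * kOf p - 1)))

/-- `c₄ = 16 d² (A² + AB + B²)`, `(A, B) = (1, 3k)`. -/
theorem twistFamily_c₄ (p d : ℕ) :
    (twistFamily p d).c₄ = 16 * (d : ℤ) ^ 2 * (1 ^ 2 + 1 * (3 * kOf p) + (3 * kOf p) ^ 2) := by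
  rw [twistFamily, transModel_c₄]; ring

/-- `Δ = 16 d⁶ (AB(A+B))²`, `(A, B) = (1, 3k)`. -/
theorem twistFamily_Δ (p d : ℕ) :
    (twistFamily p d).Δ = 16 * (d : ℤ) ^ 6 * (1 * (3 * kOf p) * (1 + 3 * kOf p)) ^ 2 := by
  rw [twistFamily, transModel_Δ]; ring

/-- `c₆ = −32 d³ (3k − 1)(3k + 2)(6k + 1)`. -/
theorem twistFamily_c₆ (p d : ℕ) :
    (twistFamily p d).c₆ =
      -32 * (d : ℤ) ^ 3 * ((3 * kOf p - 1) * (3 * kOf p + 2) * (6 * kOf p + 1)) := by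
  rw [twistFamily, transModel_c₆]; ring

/-- `c₄ (twist) = d² · c₄ (freyFamily p)`, `Δ (twist) = d⁶ · Δ (freyFamily p)`. -/
theorem twistFamily_c₄_Δ_eq (p d : ℕ) :
    (twistFamily p d).c₄ = (d : ℤ) ^ 2 * (freyFamily p).c₄ ∧
      (twistFamily p d).Δ = (d : ℤ) ^ 6 * (freyFamily p).Δ := by
  rw [twistFamily_c₄, twistFamily_Δ, freyFamily_c₄, freyFamily_Δ]
  constructor <;> ring

end TwistFamily

end Summit.ABC.ABC.Theorems.SomeWindowSaving.Negative
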